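import Literature.NumberTheory.Transcendental.PhilipponCriterionConeRank
import Literature.NumberTheory.Transcendental.PhilipponCriterionGrowth
import Literature.NumberTheory.Transcendental.NesterenkoEliminationFacts
import Literature.Barriers.Schanuel.NesterenkoModularScopeMeasureClaim
import HarnessLib

/-!
# Philippon's criterion over Nesterenko's toolkit, IX: the standing data of the proof of Théorème 2.11 — definitions

`Literature/NumberTheory/Transcendental/PhilipponCriterionSetup.lean`. Philippon proves his main
criterion (Publ. Math. IHÉS 64 (1986), Thm 2.11; the tree's named fact `Philippon1986_mainCriterion`)
by contradiction from the *hypothèse auxiliaire* (§3, p. 41): a point `θ`, growth functions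
`σ, δ, R, S`, the constant `C`, and for every `N ≥ N₀` homogenised generators `ʰQ_1^{(N)}, …` of an
ideal `I_N` with the printed degree / height / smallness / finiteness properties, together with a
prime `𝔓` vanishing at `θ` (in Diaz's form: `trdeg_ℚ ℚ(θ) ≤ k`). Every lemma of §3 (Lemmes
2.13–2.15) is stated "sous les hypothèses du théorème (2.11)". Following `CONVENTIONS.md` §9
("prefer a hypothesis structure over a tower of ad-hoc hypotheses") this file bundles exactly these
standing data and hypotheses, in the Nesterenko-invariant form produced by the glue layers
(`PhilipponCriterionHomogenization.lean` …), as the structure `PhilipponMain.Setup`, and names the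
derived quantities of the proof:

* `Setup` — `m ≥ 1` affine variables, `k ≤ m`, `θ`, `σ δ R S`, `C ≥ 1`, `N₀`, the homogenised
  generators `E N j` (homogeneous of degree `d N j ≤ δ(N)`, `h ≤ σ(N)`, `‖E‖_ω̄ ≤ e^{−S(N)}`, one of
  them outside the cone ideal of `ω̄ = (1, θ)`, finitely many common zeros in the polydisc
  `e^{−R(N)}`), the growth hypotheses of Thm 2.11, and `trdeg_ℚ ℚ(θ) ≤ k`;
* `Setup.ω`, `τ`, `g = S/(τδ^k)`, `ξ = (g/C)^{1/(k+1)}`, `Θ = |ω̄|`, `κ = 1/(4Θ²)`;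
* `Setup.𝔓₀ = 𝔭_ω̄` (the cone ideal), its rank `r₀ ∈ [1, k+1]` (`PhilipponCriterionConeRank.lean`),
  `D₀ = deg 𝔓₀`, `H₀ = h(𝔓₀)`, the size bounds `B r`, and `size N 𝔭 r = δ(N) h(𝔭) + τ(N) deg 𝔭`
  (Philippon's `Ht + τ(N) Deg` of the assertion `(A_r)`, p. 42);
* the first consequences (positivity, `g ≥ C`, `ξ ≥ 1`, `S → ∞`, rank and homogeneity of `𝔓₀`).

Nothing is asserted: the structure is inhabited from the hypotheses of `Philippon1986_mainCriterion` in
the assembling file, and every later lemma takes `(𝒮 : Setup)`.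

## References

* [Philippon1986Criteres] P. Philippon, Publ. Math. IHÉS 64 (1986), Thm 2.11 (pp. 38–39) and §3,
  pp. 41–42 (hypothèse auxiliaire, assertion `(A_r)`).
* [NesterenkoPhilippon2001] LNM 1752 (2001), Ch. 3 §4 (the invariants).
-/

noncomputable section

open MvPolynomial Filter Real
open Literature.NumberTheory.Transcendental.Nesterenko

attribute [local instance] MvPolynomial.gradedAlgebra

namespace Literature.NumberTheory.Transcendental

namespace PhilipponMain

/-- **The standing data and hypotheses of the proof of Philippon's Théorème 2.11** ("hypothèse
auxiliaire", §3 p. 41), homogenised and read through Nesterenko's invariants: `m ≥ 1` affine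
variables, the codimension parameter `k ≤ m`, the point `θ ∈ ℂ^m`, the growth functions
`σ, δ, R, S ≥ 1` (non-decreasing, `τ = σ + δ → ∞`, `S/(τδ^k)` non-decreasing, the growth inequality
with constant `C ≥ 1`), and for `N ≥ N₀` the homogenised generators `E N j ∈ ℚ[x₀, …, x_m]`
(homogeneous of degree `d N j ≤ δ(N)`, height `≤ σ(N)`, normalised value `‖E‖_ω̄ ≤ e^{−S(N)}` at
`ω̄ = (1, θ)`, one of them outside the cone ideal `𝔭_ω̄`, with finitely many common zeros `(1 : z)`,
`max |z_i − θ_i| ≤ e^{−R(N)}`), together with Diaz's hypothesis `trdeg_ℚ ℚ(θ) ≤ k` (the negation of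
the conclusion). [cite: Philippon1986Criteres, Thm 2.11 and §3 p. 41 (hypothèse auxiliaire)] -/
structure Setup where
  /-- number of affine variables (`n` in Thm 2.11) -/
  m : ℕ
  /-- the codimension parameter `k` -/
  k : ℕ
  /-- the point `θ ∈ ℂ^m` -/
  θ : Fin m → ℂ
  /-- height bound function -/
  σ : ℕ → ℝ
  /-- degree bound function -/
  δ : ℕ → ℝ
  /-- radius function (ball `e^{−R(N)}`) -/
  R : ℕ → ℝ
  /-- smallness function (values `≤ e^{−S(N)}`) -/
  S : ℕ → ℝ
  /-- the constant `C` of Thm 2.11 -/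
  C : ℝ
  /-- first level -/
  N₀ : ℕ
  /-- number of generators at level `N` -/
  M : ℕ → ℕ
  /-- the homogenised generators `ʰQ_j^{(N)}` -/
  E : (N : ℕ) → Fin (M N) → Rx m
  /-- their degrees -/
  d : (N : ℕ) → Fin (M N) → ℕ
  one_le_m : 1 ≤ m
  k_le_m : k ≤ m
  one_le_C : 1 ≤ C
  mono_σ : Monotone σ
  mono_δ : Monotone δ
  mono_R : Monotone R
  mono_S : Monotone S
  one_le_σ : ∀ N, 1 ≤ σ N
  one_le_δ : ∀ N, 1 ≤ δ N
  one_le_R : ∀ N, 1 ≤ R N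
  one_le_S : ∀ N, 1 ≤ S N
  tendsto_τ : Tendsto (fun N => σ N + δ N) atTop atTop
  mono_g : Monotone fun N => S N / ((σ N + δ N) * δ N ^ k)
  growth : ∀ N, C * (σ (N + 1) + δ (N + 1)) * δ (N + 1) ^ k * (S N ^ (k + 1) + R (N + 1) ^ (k + 1))
    ≤ S N ^ (k + 2)
  isHomogeneous_E : ∀ N j, (E N j).IsHomogeneous (d N j)
  d_le : ∀ N, N₀ ≤ N → ∀ j, (d N j : ℝ) ≤ δ N
  height_le : ∀ N, N₀ ≤ N → ∀ j, height (E N j) ≤ σ N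
  normAt_le : ∀ N, N₀ ≤ N → ∀ j, normAt (Fin.cons 1 θ : Fin (m + 1) → ℂ) (E N j) ≤ exp (-S N)
  exists_not_mem : ∀ N, N₀ ≤ N → ∃ j, E N j ∉ coneIdeal (Fin.cons 1 θ : Fin (m + 1) → ℂ)
  finite_zeros : ∀ N, N₀ ≤ N → Set.Finite {z : Fin m → ℂ |
    (∀ i, ‖z i - θ i‖ ≤ exp (-R N)) ∧ ∀ j, aeval (Fin.cons 1 z : Fin (m + 1) → ℂ) (E N j) = 0}
  trdeg_le : Algebra.trdeg ℚ ↥(IntermediateField.adjoin ℚ (Set.range θ)) ≤ k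

namespace Setup

variable (𝒮 : Setup)

/-! ### Derived quantities -/

/-- `ω̄ = (1, θ)`. [cite: Philippon1986Criteres, §3 p. 41] -/
def ω : Fin (𝒮.m + 1) → ℂ := Fin.cons 1 𝒮.θ

/-- `τ = σ + δ`. [cite: Philippon1986Criteres, Thm 2.11] -/
def τ (N : ℕ) : ℝ := 𝒮.σ N + 𝒮.δ N

/-- `g = S/(τ δ^k)` (the non-decreasing quotient of Thm 2.11). [cite: Philippon1986Criteres, Thm 2.11] -/
def g (N : ℕ) : ℝ := 𝒮.S N / ((𝒮.σ N + 𝒮.δ N) * 𝒮.δ N ^ 𝒮.k)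

/-- `ξ = (g/C)^{1/(k+1)} ≥ 1`, the loss factor of a level change (p. 45, `S(M)/R(M+1)`). [folklore] -/
def ξ (N : ℕ) : ℝ := (𝒮.g N / 𝒮.C) ^ ((1 : ℝ) / (𝒮.k + 1))

/-- `Θ = |ω̄| ≥ 1`. [folklore] -/
def Θ : ℝ := ‖𝒮.ω‖

/-- `κ = 1/(4Θ²)`, the factor comparing `ρ` with the polydisc radius. [folklore] -/
def κ : ℝ := 1 / (4 * 𝒮.Θ ^ 2)

/-- `𝔓₀ = 𝔭_ω̄`, the cone ideal of `ω̄` — the starting prime of the induction (Diaz's form of the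
prime `𝔓` of Thm 2.11). [cite: Philippon1986Criteres, Thm 2.11 (the prime 𝔓)] -/
def 𝔓₀ : Ideal (Rx 𝒮.m) := coneIdeal 𝒮.ω

/-- The rank `r₀` of `𝔓₀`, `1 ≤ r₀ ≤ k + 1` (`exists_isUnmixedOfRank_coneIdeal`). [folklore] -/
def r₀ : ℕ := Classical.choose (exists_isUnmixedOfRank_coneIdeal 𝒮.θ 𝒮.trdeg_le)

/-- `D₀ = max(deg 𝔓₀, 1)` (`= deg 𝔓₀` whenever `r₀ ≤ m`, Prop. 4.4; the `max` only matters in the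
degenerate case `𝔓₀ = (0)`, `r₀ = m + 1`, where the first cut is a principal ideal). [folklore] -/
def D₀ : ℕ := max (ideg 𝒮.𝔓₀ 𝒮.r₀) 1

/-- `H₀ = h(𝔓₀)`. [folklore] -/
def H₀ : ℝ := iheight 𝒮.𝔓₀ 𝒮.r₀

/-- The Bézout constant `c_B = 1 + m(k+2) + m²` of one cut. [folklore] -/
def cB : ℝ := 1 + (𝒮.m : ℝ) * (𝒮.k + 2) + (𝒮.m : ℝ) ^ 2

/-- The height constant of the assertion `(A_r)`: `B_r = H₀ + (r₀ − r) D₀ c_B` (so that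
`h(𝔓_{N,r}) ≤ B_r τ(N) δ(N)^{r₀−r}/δ(N)`). [cite: Philippon1986Criteres, §3 p. 42 (condition (i)_N)] -/
def B (r : ℕ) : ℝ := 𝒮.H₀ + ((𝒮.r₀ - r : ℕ) : ℝ) * 𝒮.D₀ * 𝒮.cB

/-- The size of a prime at level `N` and rank `r'`: `δ(N) h(𝔭) + τ(N) deg 𝔭` (Philippon's
`Ht_{d_N}(𝔓) + τ(N) Deg_{d_N}(𝔓)`). [cite: Philippon1986Criteres, §3 p. 42 (condition (ii)_N)] -/
def size (N : ℕ) (𝔭 : Ideal (Rx 𝒮.m)) (r' : ℕ) : ℝ :=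
  𝒮.δ N * iheight 𝔭 r' + 𝒮.τ N * ideg 𝔭 r'

/-! ### First consequences -/

/-- `ω̄₀ = 1`. [folklore] -/
theorem ω_zero : 𝒮.ω 0 = 1 := rfl

/-- `ω̄ ≠ 0`. [folklore] -/
theorem ω_ne_zero : 𝒮.ω ≠ 0 := cons_one_ne_zero 𝒮.θ

/-- `Θ ≥ 1`. [folklore] -/
theorem one_le_Θ : 1 ≤ 𝒮.Θ := one_le_norm_cons_one 𝒮.θ

/-- `Θ > 0`. [folklore] -/
theorem Θ_pos : 0 < 𝒮.Θ := lt_of_lt_of_le one_pos 𝒮.one_le_Θ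

/-- `κ > 0`. [folklore] -/
theorem κ_pos : 0 < 𝒮.κ := by unfold κ; have := 𝒮.Θ_pos; positivity

/-- `κ ≤ 1/4`. [folklore] -/
theorem κ_le : 𝒮.κ ≤ 1 / 4 := by
  unfold κ
  have h1 : (1 : ℝ) ≤ 𝒮.Θ ^ 2 := one_le_pow₀ 𝒮.one_le_Θ
  exact one_div_le_one_div_of_le (by norm_num) (by nlinarith)

/-- `C > 0`. [folklore] -/
theorem C_pos : 0 < 𝒮.C := lt_of_lt_of_le one_pos 𝒮.one_le_C

/-- `R ≥ 0`. [folklore] -/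
theorem R_nonneg (N : ℕ) : 0 ≤ 𝒮.R N := le_trans zero_le_one (𝒮.one_le_R N)

/-- `δ > 0`. [folklore] -/
theorem δ_pos (N : ℕ) : 0 < 𝒮.δ N := lt_of_lt_of_le one_pos (𝒮.one_le_δ N)

/-- `S > 0`. [folklore] -/
theorem S_pos (N : ℕ) : 0 < 𝒮.S N := lt_of_lt_of_le one_pos (𝒮.one_le_S N)

/-- `τ ≥ 1`. [folklore] -/
theorem one_le_τ (N : ℕ) : 1 ≤ 𝒮.τ N := one_le_tau 𝒮.one_le_σ 𝒮.one_le_δ N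

/-- `τ > 0`. [folklore] -/
theorem τ_pos (N : ℕ) : 0 < 𝒮.τ N := lt_of_lt_of_le one_pos (𝒮.one_le_τ N)

/-- `δ ≤ τ`. [folklore] -/
theorem δ_le_τ (N : ℕ) : 𝒮.δ N ≤ 𝒮.τ N := by unfold τ; linarith [𝒮.one_le_σ N]

/-- `σ ≤ τ`. [folklore] -/
theorem σ_le_τ (N : ℕ) : 𝒮.σ N ≤ 𝒮.τ N := by unfold τ; linarith [𝒮.one_le_δ N]

/-- `τ` is non-decreasing. [folklore] -/
theorem mono_τ : Monotone 𝒮.τ := fun _ _ h => add_le_add (𝒮.mono_σ h) (𝒮.mono_δ h)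

/-- `g ≥ C` (`growth_C_le_g`). [cite: Philippon1986Criteres, Thm 2.11] -/
theorem C_le_g (N : ℕ) : 𝒮.C ≤ 𝒮.g N :=
  growth_C_le_g 𝒮.C_pos 𝒮.mono_σ 𝒮.mono_δ 𝒮.one_le_σ 𝒮.one_le_δ 𝒮.one_le_S 𝒮.R_nonneg 𝒮.growth N

/-- `g > 0`. [folklore] -/
theorem g_pos (N : ℕ) : 0 < 𝒮.g N := lt_of_lt_of_le 𝒮.C_pos (𝒮.C_le_g N)

/-- `S(N) ≥ C τ(N) δ(N)^k`, i.e. `S = g τ δ^k`. [cite: Philippon1986Criteres, Thm 2.11] -/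
theorem S_eq (N : ℕ) : 𝒮.S N = 𝒮.g N * (𝒮.τ N * 𝒮.δ N ^ 𝒮.k) := by
  unfold g τ
  have : (𝒮.σ N + 𝒮.δ N) * 𝒮.δ N ^ 𝒮.k ≠ 0 :=
    (lt_of_lt_of_le one_pos (one_le_tau_mul_pow 𝒮.one_le_σ 𝒮.one_le_δ N)).ne'
  rw [div_mul_cancel₀ _ this]

/-- `S(N) ≥ C τ(N+1) δ(N+1)^k` (`growth_S_ge_next`). [cite: Philippon1986Criteres, §3 p. 46] -/
theorem S_ge_next (N : ℕ) : 𝒮.C * 𝒮.τ (N + 1) * 𝒮.δ (N + 1) ^ 𝒮.k ≤ 𝒮.S N :=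
  growth_S_ge_next 𝒮.one_le_S 𝒮.R_nonneg 𝒮.growth N

/-- `S(N) ≥ C τ(N) δ(N)^k`. [cite: Philippon1986Criteres, Thm 2.11] -/
theorem S_ge (N : ℕ) : 𝒮.C * 𝒮.τ N * 𝒮.δ N ^ 𝒮.k ≤ 𝒮.S N :=
  growth_S_ge 𝒮.C_pos 𝒮.mono_σ 𝒮.mono_δ 𝒮.one_le_σ 𝒮.one_le_δ 𝒮.one_le_S 𝒮.R_nonneg 𝒮.growth N

/-- `S(N) ≥ C τ(N) ≥ C`. [folklore] -/
theorem C_mul_τ_le_S (N : ℕ) : 𝒮.C * 𝒮.τ N ≤ 𝒮.S N :=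
  growth_C_mul_tau_le_S 𝒮.C_pos 𝒮.mono_σ 𝒮.mono_δ 𝒮.one_le_σ 𝒮.one_le_δ 𝒮.one_le_S 𝒮.R_nonneg
    𝒮.growth N

/-- `S ≥ C`. [folklore] -/
theorem C_le_S (N : ℕ) : 𝒮.C ≤ 𝒮.S N := by
  have h := 𝒮.C_mul_τ_le_S N
  have : 𝒮.C ≤ 𝒮.C * 𝒮.τ N := le_mul_of_one_le_right 𝒮.C_pos.le (𝒮.one_le_τ N)
  linarith

/-- `S → ∞`. [cite: Philippon1986Criteres, Thm 2.11] -/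
theorem tendsto_S : Tendsto 𝒮.S atTop atTop :=
  growth_tendsto_S 𝒮.C_pos 𝒮.mono_σ 𝒮.mono_δ 𝒮.one_le_σ 𝒮.one_le_δ 𝒮.one_le_S 𝒮.R_nonneg
    𝒮.growth 𝒮.tendsto_τ

/-- `R(N+1) ≤ S(N) ξ(N)` (`growth_R_le`). [cite: Philippon1986Criteres, §3 p. 45] -/
theorem R_succ_le (N : ℕ) : 𝒮.R (N + 1) ≤ 𝒮.S N * 𝒮.ξ N :=
  growth_R_le 𝒮.C_pos 𝒮.mono_σ 𝒮.mono_δ 𝒮.one_le_σ 𝒮.one_le_δ 𝒮.one_le_S 𝒮.R_nonneg 𝒮.growth N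

/-- `ξ ≥ 1`. [folklore] -/
theorem one_le_ξ (N : ℕ) : 1 ≤ 𝒮.ξ N :=
  growth_one_le_xi 𝒮.C_pos 𝒮.mono_σ 𝒮.mono_δ 𝒮.one_le_σ 𝒮.one_le_δ 𝒮.one_le_S 𝒮.R_nonneg
    𝒮.growth N

/-- `ξ > 0`. [folklore] -/
theorem ξ_pos (N : ℕ) : 0 < 𝒮.ξ N := lt_of_lt_of_le one_pos (𝒮.one_le_ξ N)

/-- `ξ` is non-decreasing (from the monotonicity of `g = S/(τδ^k)`).
[cite: Philippon1986Criteres, Thm 2.11 and §3 p. 45] -/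
theorem mono_ξ : Monotone 𝒮.ξ :=
  growth_monotone_xi 𝒮.C_pos 𝒮.mono_g (fun N => (𝒮.g_pos N).le)

/-- `ξ^{k+1} = g/C`. [folklore] -/
theorem ξ_pow (N : ℕ) : 𝒮.ξ N ^ (𝒮.k + 1) = 𝒮.g N / 𝒮.C := by
  unfold ξ
  have h0 : 0 ≤ 𝒮.g N / 𝒮.C := div_nonneg (𝒮.g_pos N).le 𝒮.C_pos.le
  rw [← rpow_natCast _ (𝒮.k + 1), ← rpow_mul h0]
  have : (1 : ℝ) / (𝒮.k + 1) * ((𝒮.k + 1 : ℕ) : ℝ) = 1 := by push_cast; field_simp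
  rw [this, rpow_one]

/-! ### The starting prime `𝔓₀` -/

/-- The defining property of `r₀`. [folklore] -/
theorem r₀_spec : 1 ≤ 𝒮.r₀ ∧ 𝒮.r₀ ≤ 𝒮.k + 1 ∧ IsUnmixedOfRank 𝒮.𝔓₀ 𝒮.r₀ :=
  Classical.choose_spec (exists_isUnmixedOfRank_coneIdeal 𝒮.θ 𝒮.trdeg_le)

/-- `r₀ ≥ 1`. [folklore] -/
theorem one_le_r₀ : 1 ≤ 𝒮.r₀ := 𝒮.r₀_spec.1

/-- `r₀ ≤ k + 1`. [folklore] -/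
theorem r₀_le : 𝒮.r₀ ≤ 𝒮.k + 1 := 𝒮.r₀_spec.2.1

/-- `r₀ ≤ m + 1`. [folklore] -/
theorem r₀_le_succ_m : 𝒮.r₀ ≤ 𝒮.m + 1 := 𝒮.r₀_le.trans (Nat.succ_le_succ 𝒮.k_le_m)

/-- `𝔓₀` is unmixed of rank `r₀`. [folklore] -/
theorem rank_𝔓₀ : IsUnmixedOfRank 𝒮.𝔓₀ 𝒮.r₀ := 𝒮.r₀_spec.2.2

/-- `𝔓₀` is prime. [folklore] -/
theorem isPrime_𝔓₀ : 𝒮.𝔓₀.IsPrime := isPrime_coneIdeal _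

/-- `𝔓₀` is homogeneous. [folklore] -/
theorem isHomogeneous_𝔓₀ : 𝒮.𝔓₀.IsHomogeneous (homogeneousSubmodule (Fin (𝒮.m + 1)) ℚ) :=
  isHomogeneous_coneIdeal _

/-- `ω̄ ∈ V(𝔓₀)` and `ρ_ω̄(𝔓₀) = 0`. [cite: NesterenkoPhilippon2001, Ch. 3 §5 (p. 42)] -/
theorem ω_mem_projZeros_𝔓₀ : 𝒮.ω ∈ projZeros 𝒮.𝔓₀ := mem_projZeros_coneIdeal 𝒮.ω_ne_zero

/-- `ρ_ω̄(𝔓₀) = 0`. [folklore] -/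
theorem rho_𝔓₀ : rho 𝒮.ω 𝒮.𝔓₀ = 0 := rho_coneIdeal 𝒮.ω_ne_zero

/-- `D₀ ≥ 1`. [folklore] -/
theorem one_le_D₀ : 1 ≤ 𝒮.D₀ := le_max_right _ _

/-- `deg 𝔓₀ ≤ D₀`. [folklore] -/
theorem ideg_𝔓₀_le_D₀ : ideg 𝒮.𝔓₀ 𝒮.r₀ ≤ 𝒮.D₀ := le_max_left _ _

/-- `D₀ = deg 𝔓₀` when `r₀ ≤ m` (Prop. 4.4: `deg 𝔓₀ ≥ 1`).
[cite: NesterenkoPhilippon2001, Ch. 3 Prop. 4.4 (p. 38)] -/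
theorem D₀_eq (h44 : NesterenkoPhilippon2001_ch3_prop_4_4) (hr : 𝒮.r₀ ≤ 𝒮.m) :
    𝒮.D₀ = ideg 𝒮.𝔓₀ 𝒮.r₀ :=
  max_eq_left (Literature.Barriers.Schanuel.one_le_ideg_of_isPrime h44 𝒮.one_le_r₀ hr 𝒮.isPrime_𝔓₀
    𝒮.isHomogeneous_𝔓₀ 𝒮.rank_𝔓₀)

/-- `H₀ ≥ 0`. [folklore] -/
theorem H₀_nonneg : 0 ≤ 𝒮.H₀ := height_nonneg _

/-- `c_B ≥ 1`. [folklore] -/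
theorem one_le_cB : 1 ≤ 𝒮.cB := by unfold cB; nlinarith [(Nat.cast_nonneg 𝒮.m : (0 : ℝ) ≤ 𝒮.m),
  (Nat.cast_nonneg 𝒮.k : (0 : ℝ) ≤ 𝒮.k)]

/-- `B_r ≥ 0`. [folklore] -/
theorem B_nonneg (r : ℕ) : 0 ≤ 𝒮.B r := by
  unfold B
  have := 𝒮.H₀_nonneg
  have := 𝒮.one_le_cB
  positivity

/-- `B_r` grows by `D₀ c_B` per cut: `B_r + D₀ c_B ≤ B_{r−1}` for `1 ≤ r ≤ r₀`. [folklore] -/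
theorem B_add_le (r : ℕ) (hr1 : 1 ≤ r) (hr : r ≤ 𝒮.r₀) : 𝒮.B r + 𝒮.D₀ * 𝒮.cB ≤ 𝒮.B (r - 1) := by
  unfold B
  have h : ((𝒮.r₀ - (r - 1) : ℕ) : ℝ) = ((𝒮.r₀ - r : ℕ) : ℝ) + 1 := by
    have : 𝒮.r₀ - (r - 1) = (𝒮.r₀ - r) + 1 := by omega
    rw [this]; push_cast; ring
  rw [h]
  nlinarith [𝒮.one_le_cB]

/-- `size ≥ 0`. [folklore] -/
theorem size_nonneg (N : ℕ) (𝔭 : Ideal (Rx 𝒮.m)) (r' : ℕ) : 0 ≤ 𝒮.size N 𝔭 r' :=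
  add_nonneg (mul_nonneg (𝒮.δ_pos N).le (height_nonneg _))
    (mul_nonneg (𝒮.τ_pos N).le (Nat.cast_nonneg _))

/-- `size` is non-decreasing in the level. [folklore] -/
theorem size_mono {M N : ℕ} (h : M ≤ N) (𝔭 : Ideal (Rx 𝒮.m)) (r' : ℕ) :
    𝒮.size M 𝔭 r' ≤ 𝒮.size N 𝔭 r' :=
  add_le_add (mul_le_mul_of_nonneg_right (𝒮.mono_δ h) (height_nonneg _))
    (mul_le_mul_of_nonneg_right (𝒮.mono_τ h) (Nat.cast_nonneg _))

/-- `τ(N) · deg ≤ size`. [folklore] -/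
theorem τ_mul_ideg_le_size (N : ℕ) (𝔭 : Ideal (Rx 𝒮.m)) (r' : ℕ) :
    𝒮.τ N * ideg 𝔭 r' ≤ 𝒮.size N 𝔭 r' :=
  le_add_of_nonneg_left (mul_nonneg (𝒮.δ_pos N).le (height_nonneg _))

/-- `δ(N) · h ≤ size`. [folklore] -/
theorem δ_mul_iheight_le_size (N : ℕ) (𝔭 : Ideal (Rx 𝒮.m)) (r' : ℕ) :
    𝒮.δ N * iheight 𝔭 r' ≤ 𝒮.size N 𝔭 r' :=
  le_add_of_nonneg_right (mul_nonneg (𝒮.τ_pos N).le (Nat.cast_nonneg _))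

/-! ### The assertion `(A_r)` -/

/-- The quality factor of condition `(ii)_N` at rank `r`:
`Λ_r(N) = λ · g(N) · δ(N)^{r−1} / ξ(N)^{r₀−r}` (`λ > 0` a constant depending on `r`; Philippon's
factor `(C S(N)/(τ(N)δ(N)^k))^{·/(k+1)}` of p. 42 in the index-free bookkeeping).
[cite: Philippon1986Criteres, §3 p. 42 (condition (ii)_N)] -/
def Λ (lam : ℝ) (r N : ℕ) : ℝ := lam * 𝒮.g N * 𝒮.δ N ^ (r - 1) / 𝒮.ξ N ^ (𝒮.r₀ - r)

/-- **The assertion `(A_r)` at level `N`** (Philippon 1986, §3 p. 42): a homogeneous prime `𝔓 ⊇ 𝔓₀`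
of rank `r' ≤ r` (`(0)_N`: codimension `≥ n + 1 − r`) with `(i)_N`: `deg 𝔓 ≤ D₀ δ(N)^{r₀−r}`,
`h(𝔓) ≤ B_r τ(N) δ(N)^{r₀−r}/δ(N)`, and `(ii)_N`: `|𝔓(ω̄)| ≤ exp(−Λ_r(N) · (δ(N) h(𝔓) + τ(N) deg 𝔓))`.
[cite: Philippon1986Criteres, §3 p. 42 (assertion (A_r))] -/
def Good (lam : ℝ) (N r : ℕ) (𝔓 : Ideal (Rx 𝒮.m)) : Prop :=
  𝔓.IsPrime ∧ 𝔓.IsHomogeneous (homogeneousSubmodule (Fin (𝒮.m + 1)) ℚ) ∧ 𝒮.𝔓₀ ≤ 𝔓 ∧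
    ∃ r' : ℕ, 1 ≤ r' ∧ r' ≤ r ∧ IsUnmixedOfRank 𝔓 r' ∧
      (ideg 𝔓 r' : ℝ) ≤ 𝒮.D₀ * 𝒮.δ N ^ (𝒮.r₀ - r) ∧
      iheight 𝔓 r' ≤ 𝒮.B r * 𝒮.τ N * 𝒮.δ N ^ (𝒮.r₀ - r) / 𝒮.δ N ∧
      iabs 𝔓 r' 𝒮.ω ≤ exp (-(𝒮.Λ lam r N * 𝒮.size N 𝔓 r'))

/-- `Λ ≥ 0` for `λ ≥ 0`. [folklore] -/
theorem Λ_nonneg {lam : ℝ} (hlam : 0 ≤ lam) (r N : ℕ) : 0 ≤ 𝒮.Λ lam r N := by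
  unfold Λ
  have := 𝒮.g_pos N
  have := 𝒮.δ_pos N
  have := 𝒮.ξ_pos N
  positivity

/-- `Λ` is linear in `λ`. [folklore] -/
theorem Λ_mul (a lam : ℝ) (r N : ℕ) : 𝒮.Λ (a * lam) r N = a * 𝒮.Λ lam r N := by
  unfold Λ; ring

/-- `(A_{r₀})` holds at every level with `𝔓₀` itself, for any `λ`, as soon as `|𝔓₀(ω̄)| = 0`
(which is Cor. 4.10 with `ρ_ω̄(𝔓₀) = 0`; Philippon's Lemme 2.13). [cite: Philippon1986Criteres, §3 Lemme 2.13 (p. 42)] -/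
theorem good_𝔓₀ {lam : ℝ} (N : ℕ) (h0 : iabs 𝒮.𝔓₀ 𝒮.r₀ 𝒮.ω = 0) : 𝒮.Good lam N 𝒮.r₀ 𝒮.𝔓₀ := by
  refine ⟨𝒮.isPrime_𝔓₀, 𝒮.isHomogeneous_𝔓₀, le_rfl, 𝒮.r₀, 𝒮.one_le_r₀, le_rfl, 𝒮.rank_𝔓₀, ?_, ?_, ?_⟩
  · simp only [Nat.sub_self, pow_zero, mul_one]
    exact_mod_cast 𝒮.ideg_𝔓₀_le_D₀
  · unfold B H₀
    simp only [Nat.sub_self, Nat.cast_zero, zero_mul, add_zero, pow_zero, mul_one]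
    rw [le_div_iff₀ (𝒮.δ_pos N)]
    have h1 : iheight 𝒮.𝔓₀ 𝒮.r₀ * 𝒮.δ N ≤ iheight 𝒮.𝔓₀ 𝒮.r₀ * 𝒮.τ N :=
      mul_le_mul_of_nonneg_left (𝒮.δ_le_τ N) (height_nonneg _)
    linarith
  · rw [h0]; exact (exp_pos _).le

end Setup

end PhilipponMain

end Literature.NumberTheory.Transcendental

end
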